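import Mathlib.RingTheory.MvPowerSeries.Basic
import Mathlib.RingTheory.MvPowerSeries.Inverse
import Mathlib.RingTheory.LocalRing.MaximalIdeal.Basic
import Mathlib.RingTheory.Flat.Basic
import Mathlib.LinearAlgebra.Basis.Defs
import HarnessLib

/-!
# Crux `Steer` (stmt-ResolutionOfSingularities-16345), chain W4.1, K3ᴳ / ℓ-COMPARISON plan B file (2a): power series over a FINITE field extension are a
# finite FREE module over the power series downstairs

OURS (campaign `res-hironaka`, rung L ★L-G4, slot W4.1; seat res-L0-w41-stub-2 g6; `K3G/JacobianLengthEtale-PLAN.md` f671a211d1dd908a, plan B step 2).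
Theses-free, definition-free, Mathlib-only. For a field extension `κ → κ′` with a finite basis `b : ι → κ′`, the `κ⟦X_σ⟧`-algebra `κ′⟦X_σ⟧` (Mathlib's
`MvPowerSeries.algebraMvPowerSeries`, structure map `MvPowerSeries.map (algebraMap κ κ′)`) is FREE with basis `C (b j)` — coefficientwise coordinates — hence
FLAT. This is input (F1) of `JacobianLength.length_quotient_span_derivation_le_of_flat_unramified` (p565302) read in Cohen frames. [folklore]

* `PowerSeriesFiniteExt.coeff_sum_C_mul_map` — the coefficient formula;
* `PowerSeriesFiniteExt.exists_linearEquiv_pi` — `(ι → κ⟦X⟧) ≃ₗ[κ⟦X⟧] κ′⟦X⟧`;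
* `PowerSeriesFiniteExt.free` / `PowerSeriesFiniteExt.flat`;
* `PowerSeriesFiniteExt.map_maximalIdeal_eq` — the structure map is UNRAMIFIED (`𝔪 κ′⟦X⟧ = 𝔪′`); locality is Mathlib's `MvPowerSeries.map.isLocalHom`.
-/

noncomputable section

set_option linter.dupNamespace false

open MvPowerSeries

namespace Summit.ResolutionOfSingularities.ResolutionOfSingularities.Theorems.SwitchingDichotomy.PowerSeriesFiniteExt

variable {κ κ' : Type} [Field κ] [Field κ'] [Algebra κ κ'] {σ ι : Type} [Fintype ι]

/-- Coefficients of `Σ_j C(b j) · g_j` (with `g_j ∈ κ⟦X⟧` read in `κ′⟦X⟧`): `coeff_e = Σ_j (coeff_e g_j) • b j`. -/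
theorem coeff_sum_C_mul_map (b : ι → κ') (g : ι → MvPowerSeries σ κ) (e : σ →₀ ℕ) :
    coeff e (∑ j, C (b j) * MvPowerSeries.map (algebraMap κ κ') (g j)) = ∑ j, coeff e (g j) • b j := by
  rw [map_sum]
  refine Finset.sum_congr rfl fun j _ => ?_
  rw [coeff_C_mul, coeff_map, Algebra.smul_def, mul_comm]

/-- **`κ′⟦X⟧ ≅ κ⟦X⟧^ι` as `κ⟦X⟧`-modules** for a `κ`-basis `b : ι → κ′` (finite `ι`): `g ↦ Σ_j C(b j) · g_j`, inverse = coefficientwise coordinates. -/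
theorem exists_linearEquiv_pi (b : Module.Basis ι κ κ') :
    ∃ Φ : (ι → MvPowerSeries σ κ) ≃ₗ[MvPowerSeries σ κ] MvPowerSeries σ κ',
      ∀ g, Φ g = ∑ j, C (b j) * MvPowerSeries.map (algebraMap κ κ') (g j) := by
  classical
  refine ⟨{ toFun := fun g => ∑ j, C (b j) * MvPowerSeries.map (algebraMap κ κ') (g j)
            invFun := fun h j e => b.equivFun (coeff e h) j
            map_add' := fun g g' => by
              rw [← Finset.sum_add_distrib]
              refine Finset.sum_congr rfl fun j _ => ?_
              rw [Pi.add_apply, map_add, mul_add]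
            map_smul' := fun r g => by
              rw [RingHom.id_apply, Finset.smul_sum]
              refine Finset.sum_congr rfl fun j _ => ?_
              rw [Pi.smul_apply, smul_eq_mul, map_mul, Algebra.smul_def, algebraMap_apply'', mul_left_comm]
            left_inv := fun g => by
              funext j
              ext e
              change b.equivFun (coeff e (∑ j, C (b j) * MvPowerSeries.map (algebraMap κ κ') (g j))) j = coeff e (g j)
              rw [coeff_sum_C_mul_map, ← b.equivFun_symm_apply, LinearEquiv.apply_symm_apply]
            right_inv := fun h => by
              ext e
              rw [coeff_sum_C_mul_map]
              change ∑ j, (b.equivFun (coeff e h) j) • b j = coeff e h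
              rw [← b.equivFun_symm_apply, LinearEquiv.symm_apply_apply] }, fun g => rfl⟩

/-- **`κ′⟦X⟧` is a FREE `κ⟦X⟧`-module** when `κ′/κ` has a finite basis. [folklore] -/
theorem free (b : Module.Basis ι κ κ') : Module.Free (MvPowerSeries σ κ) (MvPowerSeries σ κ') := by
  obtain ⟨Φ, -⟩ := exists_linearEquiv_pi (σ := σ) b
  exact Module.Free.of_equiv Φ

/-- **`κ′⟦X⟧` is a FLAT `κ⟦X⟧`-module** when `κ′/κ` has a finite basis (input (F1) of `JacobianLength.length_quotient_span_derivation_le_of_flat_unramified`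
in Cohen frames). [folklore] -/
theorem flat (b : Module.Basis ι κ κ') : Module.Flat (MvPowerSeries σ κ) (MvPowerSeries σ κ') := by
  haveI := free (σ := σ) b
  infer_instance

/-- Membership in the maximal ideal of power series over a field = vanishing constant term (Mathlib-only phrasing). -/
theorem mem_maximalIdeal_iff {K : Type} [Field K] (F : MvPowerSeries σ K) :
    F ∈ IsLocalRing.maximalIdeal (MvPowerSeries σ K) ↔ constantCoeff F = 0 := by
  rw [IsLocalRing.mem_maximalIdeal, mem_nonunits_iff, MvPowerSeries.isUnit_iff_constantCoeff, isUnit_iff_ne_zero, not_not]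

/-- **The structure map `κ⟦X⟧ → κ′⟦X⟧` is UNRAMIFIED**: `𝔪 · κ′⟦X⟧ = 𝔪′` (any index type `σ`; uses the basis decomposition for `⊇`). Input (F3) of
`JacobianLength.length_quotient_span_derivation_le_of_flat_unramified` in Cohen frames. [folklore] -/
theorem map_maximalIdeal_eq (b : Module.Basis ι κ κ') :
    (IsLocalRing.maximalIdeal (MvPowerSeries σ κ)).map (algebraMap (MvPowerSeries σ κ) (MvPowerSeries σ κ')) =
      IsLocalRing.maximalIdeal (MvPowerSeries σ κ') := by
  classical
  apply le_antisymm
  · rw [Ideal.map_le_iff_le_comap]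
    intro g hg
    rw [Ideal.mem_comap, mem_maximalIdeal_iff, algebraMap_apply'', ← coeff_zero_eq_constantCoeff_apply, coeff_map,
      coeff_zero_eq_constantCoeff_apply, (mem_maximalIdeal_iff g).mp hg, map_zero]
  · intro G hG
    obtain ⟨Φ, hΦ⟩ := exists_linearEquiv_pi (σ := σ) b
    obtain ⟨g, rfl⟩ := Φ.surjective G
    rw [hΦ] at hG ⊢
    have h0 : ∀ j, coeff 0 (g j) = 0 := by
      have h := (mem_maximalIdeal_iff _).mp hG
      rw [← coeff_zero_eq_constantCoeff_apply, coeff_sum_C_mul_map] at h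
      have := b.equivFun.symm.injective (a₁ := fun j => coeff 0 (g j)) (a₂ := 0)
        (by rw [b.equivFun_symm_apply, map_zero]; exact h)
      exact fun j => congrFun this j
    refine Submodule.sum_mem _ fun j _ => Ideal.mul_mem_left _ _ ?_
    rw [← algebraMap_apply'']
    exact Ideal.mem_map_of_mem _ ((mem_maximalIdeal_iff _).mpr (by rw [← coeff_zero_eq_constantCoeff_apply]; exact h0 j))

end Summit.ResolutionOfSingularities.ResolutionOfSingularities.Theorems.SwitchingDichotomy.PowerSeriesFiniteExt

end
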